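import Summits.ValiantsHypothesis.ValiantsHypothesis.Theorems.NewtonUnitEquationsTwoProductsTowerRecordLiftModel
import Summits.ValiantsHypothesis.ValiantsHypothesis.Theorems.NewtonUnitEquationsTwoProductsMomentRecordLiftClassSum

/-!
# R13 lift toolkit — polynomial forms, the tower data of the instance, and the class-sum identity

(L2/3) The degree-`D` version of R12's ✓ `…MomentRecordLiftClassSum`: the POLYNOMIAL FORM `R_j = Σ_i y_i · ψ(γ_{j i}(z))` of a pencil row
(`polyForm`; `ψ : ℂ[z] → ℂ[y,z]` is the landed `psiZ`), ★ the class-sum identity `[y^S z^k] R_j^r = 𝟙[|S| = r]·(r!/ΠS_i!)·[z^k] Π_i γ_{j i}^{S_i}`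
(`coeff_polyForm_pow`, from the landed `coeff_monomial_embS_mul_psiZ`) and its log-sum form `[E](Σ_j log_N(1+R_j) − Σ_j log_N(1+R'_j)) =
c_{|S_E|}·mult(S_E)·layerT γ γ' (E z) S_E` (`coeff_logSum_polyForm_sub`); the TOWER DATA of an instance `gammaOf` (`[z^j] γ_{j' i} = Σ_{e : λ e = y_i z^j} [e] w_{j'}`),
`liftW (lamT) (w j) = polyForm (gammaOf w) j`, its levels (`levelsIn_gammaOf`) and degree (`degLe_gammaOf`), and TAMENESS of the lifted tails for
the model weight of a valid `ξ` (`exists_tame_liftWT`, constant `min_e (−wt ξ e)/(D+1)`).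
Helper on crux `stmt-ValiantsHypothesis-5906` (line `relation_ladder`, R13 «tower record law», texts ✓ `…TowerRecordDefs`); `--supports`, closes
nothing by itself: `TowerCarrierLaw` / `SparseLevelCarrierLaw ℓ` are WIDER CLASS rungs, inert as a hatch; `PlanarCellBound`, `ResidualLawV24` and the
crux stay OPEN; VP ≠ VNP is NOT proved.  No instances, no notation, no named facts. [folklore]
-/

set_option linter.dupNamespace false

noncomputable section

open Classical

namespace Summit.ValiantsHypothesis.ValiantsHypothesis.Theorems.NewtonUnitEquations.TwoProducts.TowerRecord.Lift
open scoped BigOperators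
open MvPolynomial
open Summit.ValiantsHypothesis.ValiantsHypothesis.Theorems.NewtonUnitEquations.TwoProducts.FormalLogLinearisation
open Summit.ValiantsHypothesis.ValiantsHypothesis.Theorems.NewtonUnitEquations.TwoProducts.PlanarCell
open Summit.ValiantsHypothesis.ValiantsHypothesis.Theorems.NewtonUnitEquations.TwoProducts.MomentRecord
open Summit.ValiantsHypothesis.ValiantsHypothesis.Theorems.NewtonUnitEquations.TwoProducts.MomentRecord.Lift
open Summit.ValiantsHypothesis.ValiantsHypothesis.Theorems.NewtonUnitEquations.TwoProducts.TowerRecord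

section ClassSumFile

/-! ## Polynomial forms and the class-sum identity -/

section ClassSum

variable {m n : ℕ}

/-- The POLYNOMIAL FORM of a pencil row: `R_j = Σ_i y_i · ψ(γ_{j i}(z))`. [folklore] -/
def polyForm (γ : Fin m → Fin n → Polynomial ℂ) (j : Fin m) : MvPolynomial (Option (Fin n)) ℂ :=
  ∑ i, X (some i) * psiZ n (γ j i)

/-- **THE CLASS-SUM IDENTITY** for one row: `[E] R_j^r = 𝟙[|S_E| = r] · (r!/Π S_i!) · [z^{E(z)}] Π_i γ_{j i}^{S_E i}`. [folklore] -/
theorem coeff_polyForm_pow (γ : Fin m → Fin n → Polynomial ℂ) (j : Fin m) (r : ℕ) (E : Option (Fin n) →₀ ℕ) :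
    coeff E (polyForm γ j ^ r) =
      if ydeg E = r then (Nat.multinomial Finset.univ (fun i => E (some i)) : ℂ) *
        (∏ i, γ j i ^ E (some i)).coeff (E none) else 0 := by
  classical
  rw [polyForm, Finset.sum_pow_eq_sum_piAntidiag, coeff_sum]
  have hterm : ∀ k ∈ Finset.univ.piAntidiag r,
      coeff E ((Nat.multinomial Finset.univ k : MvPolynomial (Option (Fin n)) ℂ) *
          ∏ i, (X (some i) * psiZ n (γ j i)) ^ k i) =
        if (fun i => E (some i)) = k then (Nat.multinomial Finset.univ k : ℂ) * (∏ i, γ j i ^ k i).coeff (E none)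
        else 0 := by
    intro k _
    rw [← map_natCast (C : ℂ →+* MvPolynomial (Option (Fin n)) ℂ), coeff_C_mul]
    simp_rw [mul_pow]
    rw [Finset.prod_mul_distrib, prod_X_pow_eq_monomial_embS]
    simp_rw [← map_pow]
    rw [← map_prod, coeff_monomial_embS_mul_psiZ]
    by_cases h : (fun i => E (some i)) = k
    · rw [if_pos h, if_pos (fun i => congr_fun h i)]
    · rw [if_neg h, if_neg (fun h' => h (funext h')), mul_zero]
  rw [Finset.sum_congr rfl hterm, Finset.sum_ite_eq]
  have hmem : (fun i => E (some i)) ∈ Finset.univ.piAntidiag r ↔ ydeg E = r := by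
    rw [Finset.mem_piAntidiag]
    simp [ydeg]
  by_cases hr : ydeg E = r
  · rw [if_pos (hmem.mpr hr), if_pos hr]
  · rw [if_neg (fun h => hr (hmem.mp h)), if_neg hr]

/-- `momentPolyT` is the row sum of the pencil products (by definition). [folklore] -/
theorem momentPolyT_eq_sum_prod (γ : Fin m → Fin n → Polynomial ℂ) (S : Fin n → ℕ) :
    momentPolyT γ S = ∑ j, ∏ i, γ j i ^ S i := rfl

/-- The class-sum identity summed over the rows: `[E] Σ_j R_j^r = 𝟙[|S_E| = r] · mult(S_E) · [z^{E(z)}] momentPolyT γ S_E`. [folklore] -/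
theorem coeff_sum_polyForm_pow (γ : Fin m → Fin n → Polynomial ℂ) (r : ℕ) (E : Option (Fin n) →₀ ℕ) :
    coeff E (∑ j, polyForm γ j ^ r) =
      if ydeg E = r then (Nat.multinomial Finset.univ (fun i => E (some i)) : ℂ) *
        (momentPolyT γ fun i => E (some i)).coeff (E none) else 0 := by
  rw [coeff_sum]
  simp_rw [coeff_polyForm_pow]
  split_ifs with h
  · rw [momentPolyT_eq_sum_prod, Polynomial.finsetSum_coeff, Finset.mul_sum]
  · simp

/-- Coefficients of the truncated log-sum of the rows: `[E] Σ_j log_N(1+R_j) = c_{|S_E|} · mult(S_E) · [z^{E(z)}] momentPolyT` for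
`1 ≤ |S_E| ≤ N`, else `0`. [folklore] -/
theorem coeff_sum_logT_polyForm (γ : Fin m → Fin n → Polynomial ℂ) (N : ℕ) (E : Option (Fin n) →₀ ℕ) :
    coeff E (∑ j, logT N (polyForm γ j)) =
      if 1 ≤ ydeg E ∧ ydeg E ≤ N then ((-1 : ℂ) ^ (ydeg E + 1) / (ydeg E : ℂ)) *
        ((Nat.multinomial Finset.univ (fun i => E (some i)) : ℂ) * (momentPolyT γ fun i => E (some i)).coeff (E none)) else 0 := by
  classical
  have h : ∑ j, logT N (polyForm γ j) = ∑ r ∈ Finset.Icc 1 N, ((-1 : ℂ) ^ (r + 1) / (r : ℂ)) • ∑ j, polyForm γ j ^ r := by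
    unfold logT
    rw [Finset.sum_comm]
    refine Finset.sum_congr rfl fun r _ => ?_
    rw [Finset.smul_sum]
  rw [h, coeff_sum]
  simp_rw [coeff_smul, coeff_sum_polyForm_pow, smul_eq_mul, mul_ite, mul_zero]
  rw [Finset.sum_ite_eq]
  simp only [Finset.mem_Icc]

/-- **Coefficients of the upstairs log-sum `Λ_N` are the TOWER LAYERS**:
`[E] (Σ_j log_N(1+R_j) − Σ_j log_N(1+R'_j)) = c_{|S_E|} · mult(S_E) · layerT γ γ' (E z) S_E` for `1 ≤ |S_E| ≤ N`. [folklore] -/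
theorem coeff_logSum_polyForm_sub (γ γ' : Fin m → Fin n → Polynomial ℂ) (N : ℕ) (E : Option (Fin n) →₀ ℕ) :
    coeff E (∑ j, logT N (polyForm γ j) - ∑ j, logT N (polyForm γ' j)) =
      if 1 ≤ ydeg E ∧ ydeg E ≤ N then ((-1 : ℂ) ^ (ydeg E + 1) / (ydeg E : ℂ)) *
        (Nat.multinomial Finset.univ (fun i => E (some i)) : ℂ) * layerT γ γ' (E none) (fun i => E (some i)) else 0 := by
  rw [coeff_sub, coeff_sum_logT_polyForm, coeff_sum_logT_polyForm, layerT, Polynomial.coeff_sub]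
  split_ifs <;> ring

/-- A tower letter monomial is a carrier variable times an embedded `z`-monomial: `Y^{y_i z^j}·c = y_i · ψ(c z^j)`. [folklore] -/
theorem monomial_yzExpT_eq (i : Fin n) (j : ℕ) (c : ℂ) :
    (monomial (yzExpT i j) c : MvPolynomial (Option (Fin n)) ℂ) = X (some i) * psiZ n (Polynomial.monomial j c) := by
  rw [psiZ, ← Polynomial.C_mul_X_pow_eq_monomial, map_mul, map_pow, Polynomial.aeval_C, Polynomial.aeval_X,
    MvPolynomial.algebraMap_eq, X_pow_eq_monomial, X, C_mul_monomial, monomial_mul, yzExpT]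
  simp

end ClassSum

/-! ## The tower data of the instance and tameness -/

section Data
open Summit.ValiantsHypothesis.Theorems.TwoProducts.Negative.CommonPadding (wt_neg_of_mem_tailSupport)

variable {m n : ℕ}
variable (u v : Fin m → MvPolynomial (Fin 2) ℂ) (x : Fin n → Expo) (d : Fin 2 → ℤ) (E : Finset ℕ)

/-- The TOWER DATA of the tails `w` (= `u` or `v`): the pencil `γ_{j i}(z) = Σ_{j' ∈ E} (Σ_{e : λ e = y_i z^{j'}} [e] w_j) z^{j'}`
(the coefficient of the letter `x_i + j'•d` in factor `j` sits in degree `j'`). [folklore] -/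
def gammaOf (w : Fin m → MvPolynomial (Fin 2) ℂ) (j : Fin m) (i : Fin n) : Polynomial ℂ :=
  ∑ j' ∈ E, Polynomial.monomial j'
    (∑ e ∈ (tailSupport u v).filter (fun e => lamT u v x d E e = yzExpT i j'), coeff e (w j))

variable {u v x d E}

/-- The tower data uses only the levels in `E`. [folklore] -/
theorem levelsIn_gammaOf (w : Fin m → MvPolynomial (Fin 2) ℂ) : LevelsIn (gammaOf u v x d E w) E := by
  classical
  intro j i e he
  rw [gammaOf, Polynomial.mem_support_iff, Polynomial.finsetSum_coeff] at he
  by_contra hne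
  apply he
  refine Finset.sum_eq_zero fun j' hj' => ?_
  rw [Polynomial.coeff_monomial, if_neg]
  rintro rfl
  exact hne hj'

/-- The tower data has degree `≤ D` when the levels lie in `[0, D]`. [folklore] -/
theorem degLe_gammaOf {D : ℕ} (hED : ∀ j ∈ E, j ≤ D) (w : Fin m → MvPolynomial (Fin 2) ℂ) : DegLe (gammaOf u v x d E w) D := by
  intro j i
  rw [Polynomial.natDegree_le_iff_coeff_eq_zero]
  intro N hN
  by_contra hne
  have hmem := levelsIn_gammaOf (u := u) (v := v) (x := x) (d := d) (E := E) w j i (Polynomial.mem_support_iff.mpr hne)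
  have := hED N hmem
  exact absurd hN (by exact_mod_cast not_lt.mpr this)

/-- `yzExpT` is injective on pairs. [folklore] -/
theorem yzExpT_injOn : Set.InjOn (fun p : Fin n × ℕ => yzExpT p.1 p.2) Set.univ := by
  rintro ⟨i, j⟩ - ⟨i', j'⟩ - h
  obtain ⟨h1, h2⟩ := yzExpT_inj h
  exact Prod.ext h1 h2

/-- **The lifted tail is the polynomial form of its tower data**: `ℓ_w j = Σ_i y_i · ψ(γ_{j i})`. [folklore] -/
theorem liftW_lamT_eq_polyForm (halph : TowerAlphabet u v x d E) (w : Fin m → MvPolynomial (Fin 2) ℂ) (j : Fin m)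
    (hw : (w j).support ⊆ tailSupport u v) :
    liftW (lamT u v x d E) (w j) = polyForm (gammaOf u v x d E w) j := by
  classical
  set L := tailSupport u v with hL
  have h1 : liftW (lamT u v x d E) (w j) = ∑ e ∈ L, monomial (lamT u v x d E e) (coeff e (w j)) := by
    rw [liftW]
    exact Finset.sum_subset hw fun e _ he => by rw [notMem_support_iff.1 he, map_zero]
  set T : Finset (Option (Fin n) →₀ ℕ) := (Finset.univ ×ˢ E).image (fun p : Fin n × ℕ => yzExpT p.1 p.2) with hT
  have hmaps : ∀ e ∈ L, lamT u v x d E e ∈ T := by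
    intro e he
    obtain ⟨i, j', hj', hEx, _⟩ := isLetterExpT_lamT halph he
    exact Finset.mem_image.mpr ⟨(i, j'), Finset.mem_product.mpr ⟨Finset.mem_univ _, hj'⟩, hEx.symm⟩
  have h2 : ∑ e ∈ L, monomial (lamT u v x d E e) (coeff e (w j)) =
      ∑ Ex ∈ T, (monomial Ex (∑ e ∈ L.filter (fun e => lamT u v x d E e = Ex), coeff e (w j)) : MvPolynomial (Option (Fin n)) ℂ) := by
    rw [← Finset.sum_fiberwise_of_maps_to hmaps]
    refine Finset.sum_congr rfl fun Ex _ => ?_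
    rw [map_sum]
    refine Finset.sum_congr rfl fun e he => ?_
    rw [(Finset.mem_filter.mp he).2]
  have hinj : Set.InjOn (fun p : Fin n × ℕ => yzExpT p.1 p.2) ↑(Finset.univ ×ˢ E : Finset (Fin n × ℕ)) :=
    fun p _ q _ h => yzExpT_injOn (Set.mem_univ p) (Set.mem_univ q) h
  rw [h1, h2, hT, Finset.sum_image hinj, Finset.sum_product, polyForm]
  refine Finset.sum_congr rfl fun i _ => ?_
  rw [gammaOf, map_sum, Finset.mul_sum]
  refine Finset.sum_congr rfl fun j' _ => ?_
  rw [monomial_yzExpT_eq]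

/-- The upstairs `u`-tails are the polynomial forms of the `u`-data. [folklore] -/
theorem ellUT_eq_polyForm (halph : TowerAlphabet u v x d E) (j : Fin m) :
    ellUT (u := u) (v := v) (x := x) (d := d) (E := E) j = polyForm (gammaOf u v x d E u) j :=
  liftW_lamT_eq_polyForm halph u j fun _ he => Finset.mem_union_left _ (Finset.mem_biUnion.mpr ⟨j, Finset.mem_univ _, he⟩)

/-- The upstairs `v`-tails are the polynomial forms of the `v`-data. [folklore] -/
theorem ellVT_eq_polyForm (halph : TowerAlphabet u v x d E) (j : Fin m) :
    ellVT (u := u) (v := v) (x := x) (d := d) (E := E) j = polyForm (gammaOf u v x d E v) j :=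
  liftW_lamT_eq_polyForm halph v j fun _ he => Finset.mem_union_right _ (Finset.mem_biUnion.mpr ⟨j, Finset.mem_univ _, he⟩)

/-- **Tameness of the lifted tower tails** for the model weight of a valid `ξ`: with `c = min_e (−wt ξ e)/(D+1) > 0` over the tail letters,
every monomial `λ e` of a lifted tail has weight `wt ξ e ≤ −c · deg(λ e)` (degree `≤ D+1`). [folklore] -/
theorem exists_tame_liftWT (halph : TowerAlphabet u v x d E) {D : ℕ} (hED : ∀ j ∈ E, j ≤ D) {ξ : Fin 2 → ℝ}
    (hval : ValidWeight u v ξ) :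
    ∃ c : ℝ, 0 < c ∧ ∀ (w : Fin m → MvPolynomial (Fin 2) ℂ) (j : Fin m), (w j).support ⊆ tailSupport u v →
      Tame (κw ξ x d) c (liftW (lamT u v x d E) (w j)) := by
  classical
  set L := tailSupport u v with hL
  have hD : (0 : ℝ) < (D : ℝ) + 1 := by positivity
  by_cases hne : L.Nonempty
  · set c := (L.image fun e => - wt ξ e / ((D : ℝ) + 1)).min' (hne.image _) with hc
    have hcpos : 0 < c := by
      rw [hc, Finset.lt_min'_iff]
      intro y hy
      obtain ⟨e, he, rfl⟩ := Finset.mem_image.mp hy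
      have := wt_neg_of_mem_tailSupport hval he
      exact div_pos (by linarith) hD
    have hcle : ∀ e ∈ L, c ≤ - wt ξ e / ((D : ℝ) + 1) := fun e he =>
      Finset.min'_le _ _ (Finset.mem_image.mpr ⟨e, he, rfl⟩)
    refine ⟨c, hcpos, fun w j hw Ex hEx => ?_⟩
    rw [liftW] at hEx
    obtain ⟨e, he, hEe⟩ : ∃ e ∈ (w j).support, Ex ∈ (monomial (lamT u v x d E e) (coeff e (w j))).support := by
      by_contra h
      push Not at h
      have : Ex ∉ (∑ e ∈ (w j).support, monomial (lamT u v x d E e) (coeff e (w j))).support := by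
        intro hmem
        obtain ⟨e, he, hEe⟩ := Finset.mem_biUnion.mp (support_sum hmem)
        exact h e he hEe
      exact this hEx
    have hEeq : Ex = lamT u v x d E e := by
      rw [support_monomial] at hEe
      split_ifs at hEe with h0
      · simp at hEe
      · exact Finset.mem_singleton.mp hEe
    have heL : e ∈ L := hw he
    obtain ⟨hpt, hyd, hk⟩ := (isLetterExpT_lamT halph heL).pt_eq (x := x) (d := d)
    rw [hEeq, lw_κw, hpt, wtZ_ιZ, degree_eq_ydeg_add, hyd]
    have hlev : ((lamT u v x d E e) none : ℝ) ≤ D := by exact_mod_cast hED _ hk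
    have h1 := hcle e heL
    have h2 : c * ((D : ℝ) + 1) ≤ - wt ξ e := by
      have := (le_div_iff₀ hD).mp h1
      linarith
    have h3 : c * ((1 + (lamT u v x d E e) none : ℕ) : ℝ) ≤ c * ((D : ℝ) + 1) := by
      push_cast
      nlinarith
    linarith
  · refine ⟨1, one_pos, fun w j hw Ex hEx => ?_⟩
    exfalso
    rw [Finset.not_nonempty_iff_eq_empty] at hne
    have hsupp : (w j).support = ∅ := Finset.subset_empty.mp (hne ▸ hw)
    rw [liftW, hsupp, Finset.sum_empty, support_zero] at hEx
    simp at hEx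

end Data

end ClassSumFile

end Summit.ValiantsHypothesis.ValiantsHypothesis.Theorems.NewtonUnitEquations.TwoProducts.TowerRecord.Lift

end
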